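import Summits.Ventures.PackingBounds.Configurations.Dim23Card552HistB
import Summits.Ventures.PackingBounds.SphericalCodes.Dim23N552
import Summits.Ventures.PackingBounds.Energy.UniversalOptimality

/-!
# The 552-point sharp configuration (276 equiangular lines in `ℝ²³`, `Co₃`) as an explicit section of the Leech lattice: `A(23, arccos 1/5) = 552` and the ground-state energy on `S^22`

Framing: lottery ticket; floor = certified bounds/negative ranges. Venture `PackingBounds` (cell
`pub-packcert`, seat `pub-packcert-energy`) — the **attained side** for `(n, N) = (23, 552)`.

`vecs` lists the `552` minimal vectors `v` with `⟨v,u⟩ = 24` for a type-3 vector `u` (`u·u = 48`), as `2v - u ⊥ u`: the `276` equiangular line pairs of `ℝ²³`, inner products `-1` (1) and `∓1/5` (275 each) (Cohn–Kumar's Table 1). The ambient coordinates are those of the Leech lattice `Λ₂₄` scaled by `√8` (integer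
coordinates, minimal vectors of squared length `32`, built from the extended Golay code as in
Conway–Sloane Ch. 4 §11); the configuration is cut out of the `196560` minimal vectors by prescribing
inner products with fixed lattice vectors and then projected orthogonally to them (integer `normals`,
pairwise orthogonal), so that `Config.exists_section` moves it to the right dimension. The kernel
checks the squared lengths, the distance distribution and the orthogonality exactly.
With the cell's bounds: `A(23, arccos 1/5) = 552` (`IsGreatest`, with `SphericalCodes.code_dim23_le_552`) and the
ground-state energy of `552` points on `S^22` for every absolutely monotonic potential (`IsLeast`,
with `Energy.UniversalDim23Card552…`).

## References
* H. Cohn, A. Kumar, J. Amer. Math. Soc. 20 (2007) 99–148, Table 1. [`CohnKumar2006`]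
* J. H. Conway, N. J. A. Sloane, *Sphere Packings, Lattices and Groups*, Ch. 4 §11, Ch. 10 §3. [`ConwaySloane1999`]

The data and the kernel checks are split over `Configurations/Dim23Card552Data` (coordinates, shape, table,
normals, histogram chunks `0`–`11`), the `Configurations/Dim23Card552Hist*` files (chunks `12`–`24`)
and this file (chunks `25`–`34`, assembly, theorems).
-/

namespace Summit.Ventures.PackingBounds.Config.Dim23Card552

open Finset Summit.Ventures.PackingBounds.Config

set_option maxRecDepth 100000 in
/-- Kernel check (distance distribution), rows of chunk `25` against the whole configuration. -/
theorem hist_25 : histOK vecs table vecs25 = true := by decide +kernel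

set_option maxRecDepth 100000 in
/-- Kernel check (distance distribution), rows of chunk `26` against the whole configuration. -/
theorem hist_26 : histOK vecs table vecs26 = true := by decide +kernel

set_option maxRecDepth 100000 in
/-- Kernel check (distance distribution), rows of chunk `27` against the whole configuration. -/
theorem hist_27 : histOK vecs table vecs27 = true := by decide +kernel

set_option maxRecDepth 100000 in
/-- Kernel check (distance distribution), rows of chunk `28` against the whole configuration. -/
theorem hist_28 : histOK vecs table vecs28 = true := by decide +kernel

set_option maxRecDepth 100000 in
/-- Kernel check (distance distribution), rows of chunk `29` against the whole configuration. -/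
theorem hist_29 : histOK vecs table vecs29 = true := by decide +kernel

set_option maxRecDepth 100000 in
/-- Kernel check (distance distribution), rows of chunk `30` against the whole configuration. -/
theorem hist_30 : histOK vecs table vecs30 = true := by decide +kernel

set_option maxRecDepth 100000 in
/-- Kernel check (distance distribution), rows of chunk `31` against the whole configuration. -/
theorem hist_31 : histOK vecs table vecs31 = true := by decide +kernel

set_option maxRecDepth 100000 in
/-- Kernel check (distance distribution), rows of chunk `32` against the whole configuration. -/
theorem hist_32 : histOK vecs table vecs32 = true := by decide +kernel

set_option maxRecDepth 100000 in
/-- Kernel check (distance distribution), rows of chunk `33` against the whole configuration. -/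
theorem hist_33 : histOK vecs table vecs33 = true := by decide +kernel

set_option maxRecDepth 100000 in
/-- Kernel check (distance distribution), rows of chunk `34` against the whole configuration. -/
theorem hist_34 : histOK vecs table vecs34 = true := by decide +kernel

/-- The distance distribution of the whole configuration (chunks combined). -/
private theorem hist_vecs : histOK vecs table vecs = true := by
  show histOK vecs table (vecs0 ++ vecs1 ++ vecs2 ++ vecs3 ++ vecs4 ++ vecs5 ++ vecs6 ++ vecs7 ++ vecs8 ++ vecs9 ++ vecs10 ++ vecs11 ++ vecs12 ++ vecs13 ++ vecs14 ++ vecs15 ++ vecs16 ++ vecs17 ++ vecs18 ++ vecs19 ++ vecs20 ++ vecs21 ++ vecs22 ++ vecs23 ++ vecs24 ++ vecs25 ++ vecs26 ++ vecs27 ++ vecs28 ++ vecs29 ++ vecs30 ++ vecs31 ++ vecs32 ++ vecs33 ++ vecs34) = true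
  simp only [histOK_append, hist_0, hist_1, hist_2, hist_3, hist_4, hist_5, hist_6, hist_7, hist_8, hist_9, hist_10, hist_11, hist_12, hist_13, hist_14, hist_15, hist_16, hist_17, hist_18, hist_19, hist_20, hist_21, hist_22, hist_23, hist_24, hist_25, hist_26, hist_27, hist_28, hist_29, hist_30, hist_31, hist_32, hist_33, hist_34, Bool.and_self]

/-- The coordinate lists are pairwise distinct (from the checks). -/
private theorem nodup_vecs : vecs.Nodup := nodup_of_checks shape_vecs keys_table hist_vecs

/-- `ι q > 0`. -/
private theorem hq : 0 < (Int.castRingHom ℝ) (80 : ℤ) := by simp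

/-- **The configuration in `ℝ^23`**: `552` unit vectors of `ℝ^23` with pairwise inner products
`≤ 1 / 5` (the tabulated values) and, for every potential `a`, `a`-energy equal to the tabulated
value (section of the ambient list configuration, moved to `ℝ^23` by `Config.exists_section`). -/
theorem exists_config : ∃ C : Finset (EuclideanSpace ℝ (Fin 23)), C.card = 552 ∧ (∀ x ∈ C, ‖x‖ = 1) ∧
    (∀ x ∈ C, ∀ y ∈ C, x ≠ y → inner ℝ x y ≤ 1 / 5) ∧
    ∀ a : ℝ → ℝ, ∑ x ∈ C, ∑ y ∈ C.erase x, a (inner ℝ x y) =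
      (552 : ℝ) * (a (-1) + 275 * a (-1 / 5) + 275 * a (1 / 5)) := by
  obtain ⟨C, hc, hn, hi, he⟩ := exists_section Int.cast_injective hq shape_vecs keys_table hist_vecs
    nodup_vecs normals normals_ok orth_ok (n := 23) (by decide)
  refine ⟨C, by rw [hc, length_vecs], hn, fun x hx y hy hxy => ?_, fun a => ?_⟩
  · obtain ⟨p, hp, hpe⟩ := hi x hx y hy hxy
    rw [hpe]
    simp only [table, List.mem_cons, List.not_mem_nil, or_false] at hp
    rcases hp with rfl | rfl | rfl <;> norm_num
  · rw [he a, length_vecs]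
    simp only [table, List.map_cons, List.map_nil, List.sum_cons, List.sum_nil, Nat.cast_ofNat, Nat.cast_one]
    norm_num
    ring

/-- **Attained**: `552` unit vectors of `ℝ^23` with pairwise inner products `≤ 1 / 5`. [cite: CohnKumar2006, Table 1] -/
theorem exists_code_552 : ∃ C : Finset (EuclideanSpace ℝ (Fin 23)),
    C.card = 552 ∧ (∀ x ∈ C, ‖x‖ = 1) ∧ (∀ x ∈ C, ∀ y ∈ C, x ≠ y → inner ℝ x y ≤ 1 / 5) := by
  obtain ⟨C, hc, hn, hi, _⟩ := exists_config
  exact ⟨C, hc, hn, hi⟩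

/-- **`A(23, arccos 1/5) = 552`** (two-sided: kernel-checked LP bound + this configuration). [cite: CohnKumar2006, Table 1] -/
theorem code_isGreatest : IsGreatest {N : ℕ | ∃ C : Finset (EuclideanSpace ℝ (Fin 23)), C.card = N ∧ (∀ x ∈ C, ‖x‖ = 1) ∧
      (∀ x ∈ C, ∀ y ∈ C, x ≠ y → inner ℝ x y ≤ 1 / 5)} 552 := by
  refine ⟨exists_code_552, ?_⟩
  rintro N ⟨C, rfl, h1, h2⟩
  exact SphericalCodes.code_dim23_le_552 C h1 h2

/-- **Ground-state energy of `552` points on `S^22`** for every absolutely monotonic potential (universal optimality lower bound + attained). [cite: CohnKumar2006, Theorem 1.2] -/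
theorem energy_isLeast (a : ℝ → ℝ) (ha : AbsolutelyMonotoneOn a (Set.Ico (-1) 1)) :
    IsLeast {E : ℝ | ∃ C : Finset (EuclideanSpace ℝ (Fin 23)), (∀ x ∈ C, ‖x‖ = 1) ∧ C.card = 552 ∧
      E = ∑ x ∈ C, ∑ y ∈ C.erase x, a (inner ℝ x y)}
      ((552 : ℝ) * (a (-1) + 275 * a (-1 / 5) + 275 * a (1 / 5))) := by
  obtain ⟨C, hc, hn, _, he⟩ := exists_config
  refine ⟨⟨C, hn, hc, (he a).symm⟩, ?_⟩
  rintro E ⟨C', h1, hN, rfl⟩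
  exact Energy.UniversalDim23Card552.universallyOptimal_of_absolutelyMonotoneOn a ha C' h1 hN

end Summit.Ventures.PackingBounds.Config.Dim23Card552
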